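import Summits.QuantumFields.BalabanUV.Beta.FP.CoarseCovarianceStripBound
import Summits.QuantumFields.BalabanUV.Beta.FP.CoarseCovarianceStripCalculus

/-!
# `BalabanUV.Beta.FP.CoarseCovarianceStripReg` — road «FP» (binder row D1), row H′2-IR ∕ IR-2 (ii), file (ii) part 3: **REGULARITY OF THE ALIAS
# CORRECTION `E_n` ON THE FAT REGION** — every entry of `E_n(k)` is holomorphic in each coordinate slice at every point of `Fat D rA` and
# `E_n` is continuous there (matrix-valued), hence the tree's Cauchy-estimate lemma `B4StripCauchy.imLipschitz_of_fat` BY NAME gives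
# **`‖E_n(k) − E_n(Re k)‖_{αβ} ≤ (ME/rA)·Σ_i |Im k_i|`** on every thin strip `Strip D κ`, `κ ≤ rA`, uniformly in `n`

HONEST FRAMING (cell contract, verbatim): «discharging `BetaPertH` makes Bałaban's UV stability UNCONDITIONAL — a real constructive-QFT
result; it is NOT the continuum limit and NOT the Clay problem.»  HONEST DEPENDENCY (verbatim): «continuum YM on T⁴ ⇐ BetaPertH ∧ nine
spine estimates (0/9 proved); BetaPertH ⇐ (D1) ∧ (D4) ∧ CAP+tail; G-an2-4 gates asym, D1 and NE2/3/4.»  THIS MODULE DISCHARGES NOTHING of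
D1 ∕ BetaPertH: [folklore] one-variable calculus over files (F2)(Alias)(ii) and the toolkit `CoarseCovarianceStripCalculus` BY NAME
(`differentiableAt_feynC_update`, `PC_alias_bound`, `norm_En_le`, `differentiableAt_inv_apply`, `continuousOn_matrix_inv_of_det`, `imLipschitz_of_fat`).
No def; no `def … : Prop`; nothing is cited; 0 sorry.  NOT summit progress; NOT BetaPertH, NOT continuum, NOT Clay.

ABSOLUTE RULE (cell, verbatim): «No internally-minted statement may enter as a cited fact. Every hypothesis is either kernel-proved in this
package or a verbatim quotation of a PUBLISHED theorem with page reference. The manuscript(s) under audit are NOT citable for their own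
disputed steps — they are the thing under adjudication; programme-internal (2001/route/tribunal) claims are never citable.»

CONTENT (`D = d+1`).
* §1 `differentiable_gsum`, `continuous_gsum`, `continuous_cweight`, `differentiableAt_cweight_update`.
* §2 alias points under a coordinate update: `aliasPt_update_coord`, `neg_update`, `continuous_aliasPt`, `abs_im_alias_le`, `two_rA_lt_kappa166`,
  `aliasPt_mem_PStrip_of_fat`.
* §3 slice holomorphy at fat points: `differentiableAt_feynC_alias_update`, **`differentiableAt_PC_alias_update`** (`l ≠ 0`), `differentiableAt_cweight_alias_update`
  ∕ `_neg_`, `differentiableAt_Ftil_update`, **`differentiableAt_En_update`**.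
* §4 **`En_imLipschitz`**.
* §5 matrix-valued continuity on `Fat D rA`: `continuousOn_feynC_alias`, `continuousOn_PC_alias`, `continuous_Dw`∕`_Dwm`, `continuousOn_Dwi_zero`∕`_Dwmi_zero`,
  `continuousOn_Ftil`, **`continuousOn_En`**, `continuousOn_Bn`.
Unit `b2b-balaban-beta-d1-formalise-leaf-06` (gen 8), owner ruling R-FP-21 (A3)∕(C).
-/

noncomputable section

namespace Summit.QuantumFields.BalabanUV.Beta.FP.CoarseCovarianceStripReg

open Finset Complex Set Metric Matrix
open scoped BigOperators ComplexConjugate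
open Literature.MathematicalPhysics.QuantumFieldTheory.Balaban1983to89
open B4Strip (Strip ofRealVec reVec)
open B4StripCauchy (Fat imLipschitz_of_fat)
open B5Symbol166Strip (kappa166 kappa166_pos)
open Summit.QuantumFields.BalabanUV.Beta.GAN24.FibreSymbols (gsum)
open Summit.QuantumFields.BalabanUV.Beta.GAN24.AliasDecimate (aliasPt)
open Summit.QuantumFields.BalabanUV.Beta.GAN24.PushSumSymbol (cweight)
open Summit.QuantumFields.BalabanUV.Beta.FP.CoarseCovarianceStripW
open Summit.QuantumFields.BalabanUV.Beta.FP.CoarseCovarianceStripFeyn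
open Summit.QuantumFields.BalabanUV.Beta.FP.CoarseCovarianceStripFeynReg
open Summit.QuantumFields.BalabanUV.Beta.FP.CoarseCovarianceStripProp
open Summit.QuantumFields.BalabanUV.Beta.FP.CoarseCovarianceStripAlias
open Summit.QuantumFields.BalabanUV.Beta.FP.CoarseCovarianceStripAliasWeights (aliasPt_apply' aliasPt_im)
open Summit.QuantumFields.BalabanUV.Beta.FP.CoarseCovarianceStrip
open Summit.QuantumFields.BalabanUV.Beta.FP.CoarseCovarianceStripBound
open Summit.QuantumFields.BalabanUV.Beta.FP.CoarseCovarianceStripCalculus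

variable {d : ℕ}

/-! ## §1 The geometric sums and contour weights are entire -/

/-- [folklore] `z ↦ gsum z n` is entire (a finite sum of exponentials). -/
theorem differentiable_gsum (n : ℕ) : Differentiable ℂ fun z : ℂ => gsum z n := fun z => by
  unfold gsum
  exact DifferentiableAt.fun_sum fun t _ => ((differentiableAt_id.const_mul I).mul_const (t : ℂ)).cexp

/-- [folklore] `z ↦ gsum z n` is continuous. -/
theorem continuous_gsum (n : ℕ) : Continuous fun z : ℂ => gsum z n := (differentiable_gsum n).continuous

/-- [folklore] the contour weight `q ↦ cweight n κ q` is continuous on `ℂ^D`. -/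
theorem continuous_cweight (n : ℕ) (κ : Fin (d + 1)) : Continuous fun q : Fin (d + 1) → ℂ => cweight n κ q := by
  unfold cweight
  exact (continuous_finsetProd _ fun i _ => (continuous_gsum n).comp (continuous_apply i)).mul
    ((continuous_gsum n).comp (continuous_apply κ))

/-- [folklore] one coordinate of an updated vector through `gsum` is differentiable in the update variable. -/
theorem differentiableAt_gsum_update (n : ℕ) (q : Fin (d + 1) → ℂ) (i j : Fin (d + 1)) (z : ℂ) :
    DifferentiableAt ℂ (fun w => gsum (Function.update q i w j) n) z := by
  by_cases h : j = i
  · subst h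
    simp only [Function.update_self]
    exact differentiable_gsum n z
  · simp only [Function.update_of_ne h]
    exact differentiableAt_const _

/-- [folklore] the contour weight is differentiable in every coordinate slice, everywhere. -/
theorem differentiableAt_cweight_update (n : ℕ) (κ : Fin (d + 1)) (q : Fin (d + 1) → ℂ) (i : Fin (d + 1)) (z : ℂ) :
    DifferentiableAt ℂ (fun w => cweight n κ (Function.update q i w)) z := by
  unfold cweight
  exact (DifferentiableAt.fun_finsetProd fun j _ => differentiableAt_gsum_update n q i j z).mul (differentiableAt_gsum_update n q i κ z)

/-! ## §2 Alias points under a coordinate update -/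

/-- [folklore] updating coordinate `i` of `q` updates coordinate `i` of every alias point, affinely: `(q with q_i := w)_l = (q_l with i := (w + 2πl_i)/n)`. -/
theorem aliasPt_update_coord (n : ℕ) (l : Fin (d + 1) → Fin n) (q : Fin (d + 1) → ℂ) (i : Fin (d + 1)) (w : ℂ) :
    aliasPt n l (Function.update q i w) = Function.update (aliasPt n l q) i ((w + 2 * Real.pi * ((l i : ℕ) : ℂ)) / n) := by
  funext j
  by_cases h : j = i
  · subst h
    simp [aliasPt_apply']
  · simp [aliasPt_apply', Function.update_of_ne h]

/-- [folklore] negation commutes with a coordinate update. -/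
theorem neg_update (p : Fin (d + 1) → ℂ) (i : Fin (d + 1)) (w : ℂ) : -Function.update p i w = Function.update (-p) i (-w) := by
  funext j
  by_cases h : j = i
  · subst h; simp
  · simp [Function.update_of_ne h]

/-- [folklore] `k ↦ k_l` is continuous. -/
theorem continuous_aliasPt (n : ℕ) (l : Fin (d + 1) → Fin n) : Continuous fun k : Fin (d + 1) → ℂ => aliasPt n l k :=
  continuous_pi fun j => by
    simp only [aliasPt_apply']
    exact ((continuous_apply j).add continuous_const).div_const _

/-- [folklore] the alias map does not increase `|Im|`: `|Im (k_l)_j| ≤ |Im k_j|` (`n ≥ 1`). -/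
theorem abs_im_alias_le (n : ℕ) [NeZero n] (l : Fin (d + 1) → Fin n) (q : Fin (d + 1) → ℂ) (j : Fin (d + 1)) :
    |(aliasPt n l q j).im| ≤ |(q j).im| := by
  rw [aliasPt_im, abs_div, Nat.abs_cast]
  exact div_le_self (abs_nonneg _) (by exact_mod_cast Nat.one_le_iff_ne_zero.mpr (NeZero.ne n))

/-- [folklore] `2·rA < κ₁₆₆` (`2rA ≤ κ₀ ≤ r_F = κ₁₆₆/4`). -/
theorem two_rA_lt_kappa166 (d : ℕ) : 2 * rA d < kappa166 (d + 1) := by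
  linarith [two_rA_le_kap0 d, kap0_le_rF d, two_rF_lt d, rF_pos d]

/-- [folklore] every alias point of a fat coarse momentum lies in the periodic strip of width `κ₁₆₆`. -/
theorem aliasPt_mem_PStrip_of_fat (n : ℕ) [NeZero n] {q : Fin (d + 1) → ℂ} (hq : q ∈ Fat (d + 1) (rA d)) (l : Fin (d + 1) → Fin n) :
    aliasPt n l q ∈ PStrip (d + 1) (kappa166 (d + 1)) := fun j =>
  ((abs_im_alias_le n l q j).trans (hq j).2).trans (two_rA_lt_kappa166 d).le

/-! ## §3 Slice holomorphy at the points of the fat region -/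

/-- [our object] the Feynman matrix at an alias point is holomorphic in each coordinate slice of the COARSE momentum, at every fat point. -/
theorem differentiableAt_feynC_alias_update (n : ℕ) [NeZero n] {q : Fin (d + 1) → ℂ} (hq : q ∈ Fat (d + 1) (rA d))
    (l : Fin (d + 1) → Fin n) (i a b : Fin (d + 1)) :
    DifferentiableAt ℂ (fun w => feynC (aliasPt n l (Function.update q i w)) a b) (q i) := by
  have hp := aliasPt_mem_PStrip_of_fat n hq l
  have e : (fun w => feynC (aliasPt n l (Function.update q i w)) a b)
      = (fun w' => feynC (Function.update (aliasPt n l q) i w') a b) ∘ (fun w => (w + 2 * Real.pi * ((l i : ℕ) : ℂ)) / n) := by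
    funext w; simp only [Function.comp_apply, aliasPt_update_coord]
  rw [e]
  refine DifferentiableAt.comp (q i) ?_ ((differentiableAt_id.add_const _).div_const _)
  refine differentiableAt_feynC_update hp i ?_ a b
  have him : ((q i + 2 * Real.pi * ((l i : ℕ) : ℂ)) / n).im = (aliasPt n l q i).im := by rw [aliasPt_apply']
  rw [him]
  exact lt_of_le_of_lt ((abs_im_alias_le n l q i).trans (hq i).2) (two_rA_lt_kappa166 d)

/-- [our object] **the perfect propagator symbol at an alias point `l ≠ 0` is holomorphic in each coordinate slice of the coarse momentum at every
fat point** (Cramer + `PC_alias_bound`'s invertibility). -/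
theorem differentiableAt_PC_alias_update (n : ℕ) [NeZero n] {q : Fin (d + 1) → ℂ} (hq : q ∈ Fat (d + 1) (rA d))
    {l : Fin (d + 1) → Fin n} (hl : l ≠ fun _ => 0) (i a b : Fin (d + 1)) :
    DifferentiableAt ℂ (fun w => PC (aliasPt n l (Function.update q i w)) a b) (q i) := by
  unfold PC
  refine differentiableAt_inv_apply (A := fun w => feynC (aliasPt n l (Function.update q i w)))
    (fun a' b' => differentiableAt_feynC_alias_update n hq l i a' b') ?_ a b
  simp only [Function.update_eq_self]
  exact (PC_alias_bound n hq hl).1.ne_zero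

/-- [folklore] the contour weight at an alias point is differentiable in each coordinate slice. -/
theorem differentiableAt_cweight_alias_update (n : ℕ) (κ : Fin (d + 1)) (l : Fin (d + 1) → Fin n) (q : Fin (d + 1) → ℂ) (i : Fin (d + 1))
    (z : ℂ) : DifferentiableAt ℂ (fun w => cweight n κ (aliasPt n l (Function.update q i w))) z := by
  simp only [aliasPt_update_coord]
  exact (differentiableAt_cweight_update n κ _ i _).comp z ((differentiableAt_id.add_const _).div_const _)

/-- [folklore] the reflected contour weight at an alias point is differentiable in each coordinate slice. -/
theorem differentiableAt_cweight_neg_alias_update (n : ℕ) (lam : Fin (d + 1)) (l : Fin (d + 1) → Fin n) (q : Fin (d + 1) → ℂ)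
    (i : Fin (d + 1)) (z : ℂ) : DifferentiableAt ℂ (fun w => cweight n lam (-aliasPt n l (Function.update q i w))) z := by
  simp only [aliasPt_update_coord, neg_update]
  exact (differentiableAt_cweight_update n lam _ i _).comp z ((differentiableAt_id.add_const _).div_const _).neg

/-- [our object] `Ftil` is slice-holomorphic at every fat point. -/
theorem differentiableAt_Ftil_update (n : ℕ) [NeZero n] {q : Fin (d + 1) → ℂ} (hq : q ∈ Fat (d + 1) (rA d)) (i κ lam : Fin (d + 1)) :
    DifferentiableAt ℂ (fun w => Ftil n (Function.update q i w) κ lam) (q i) := by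
  simp only [Ftil_apply]
  refine DifferentiableAt.fun_sum fun l hl => ?_
  exact ((differentiableAt_cweight_alias_update n κ l q i _).mul (differentiableAt_cweight_neg_alias_update n lam l q i _)).mul
    (differentiableAt_PC_alias_update n hq (Finset.ne_of_mem_erase hl) i κ lam)

/-- [our object] **`En` IS SLICE-HOLOMORPHIC AT EVERY POINT OF THE FAT REGION** (the hypothesis `hdiff` of `imLipschitz_of_fat`). -/
theorem differentiableAt_En_update (n : ℕ) [NeZero n] {q : Fin (d + 1) → ℂ} (hq : q ∈ Fat (d + 1) (rA d)) (i α β : Fin (d + 1)) :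
    DifferentiableAt ℂ (fun w => En n (Function.update q i w) α β) (q i) := by
  unfold En
  refine differentiableAt_mul_apply (differentiableAt_mul_apply (differentiableAt_mul_apply ?_ ?_) ?_) ?_ α β
  · exact fun a b => differentiableAt_feynC_alias_update n hq _ i a b
  · intro a b
    unfold Dwi
    refine differentiableAt_diagonal_apply (fun κ => (differentiableAt_cweight_alias_update n κ _ q i _).inv ?_) a b
    simp only [Function.update_eq_self]
    exact cw0_ne n hq κ
  · exact fun a b => differentiableAt_Ftil_update n hq i a b
  · intro a b
    unfold Dwmi
    refine differentiableAt_diagonal_apply (fun lam => (differentiableAt_cweight_neg_alias_update n lam _ q i _).inv ?_) a b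
    simp only [Function.update_eq_self]
    exact cwm0_ne n hq lam

/-! ## §4 The imaginary-direction Lipschitz bound of `En` -/

/-- [our object] **`‖En n k α β − En n (Re k) α β‖ ≤ (ME/rA)·Σ_i |Im k_i|`** for `k ∈ Strip D κ`, `0 ≤ κ ≤ rA`, every `n ≥ 1`
(the tree's `B4StripCauchy.imLipschitz_of_fat` BY NAME on the fat region `Fat D rA`, with `differentiableAt_En_update` and `norm_En_le`). -/
theorem En_imLipschitz (n : ℕ) [NeZero n] {κ : ℝ} (hκ0 : 0 ≤ κ) (hκ : κ ≤ rA d) {k : Fin (d + 1) → ℂ} (hk : k ∈ Strip (d + 1) κ)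
    (α β : Fin (d + 1)) : ‖En n k α β - En n (ofRealVec (reVec k)) α β‖ ≤ ME d / rA d * ∑ i, |(k i).im| :=
  imLipschitz_of_fat (fun q => En n q α β) (rA_pos d) hκ0 hκ (fun _ hq μ => differentiableAt_En_update n hq μ α β)
    (fun _ hq => norm_En_le n hq α β) k hk

/-! ## §5 Matrix-valued continuity on the fat region -/

/-- [our object] `k ↦ feynC (k_l)` is continuous on `Fat D rA` (matrix-valued). -/
theorem continuousOn_feynC_alias (n : ℕ) [NeZero n] (l : Fin (d + 1) → Fin n) :
    ContinuousOn (fun k : Fin (d + 1) → ℂ => feynC (aliasPt n l k)) (Fat (d + 1) (rA d)) :=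
  continuousOn_matrix_of_entries fun a b =>
    (continuousOn_feynC (kappa166_pos _).le le_rfl a b).comp (continuous_aliasPt n l).continuousOn fun _ hk => aliasPt_mem_PStrip_of_fat n hk l

/-- [our object] `k ↦ PC (k_l)` is continuous on `Fat D rA` for `l ≠ 0` (matrix-valued; `det ≠ 0` by `PC_alias_bound`). -/
theorem continuousOn_PC_alias (n : ℕ) [NeZero n] {l : Fin (d + 1) → Fin n} (hl : l ≠ fun _ => 0) :
    ContinuousOn (fun k : Fin (d + 1) → ℂ => PC (aliasPt n l k)) (Fat (d + 1) (rA d)) := by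
  unfold PC
  exact continuousOn_matrix_inv_of_det (continuousOn_feynC_alias n l) fun k hk => (PC_alias_bound n hk hl).1.ne_zero

/-- [folklore] `k ↦ Dw n l k` is continuous. -/
theorem continuous_Dw (n : ℕ) (l : Fin (d + 1) → Fin n) : Continuous fun k : Fin (d + 1) → ℂ => Dw n l k := by
  unfold Dw
  exact (continuous_pi fun κ => (continuous_cweight n κ).comp (continuous_aliasPt n l)).matrix_diagonal

/-- [folklore] `k ↦ Dwm n l k` is continuous. -/
theorem continuous_Dwm (n : ℕ) (l : Fin (d + 1) → Fin n) : Continuous fun k : Fin (d + 1) → ℂ => Dwm n l k := by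
  unfold Dwm
  exact (continuous_pi fun lam => (continuous_cweight n lam).comp (continuous_aliasPt n l).neg).matrix_diagonal

/-- [folklore] `k ↦ Dwi₀` is continuous on `Fat D rA` (the `l = 0` weights do not vanish there). -/
theorem continuousOn_Dwi_zero (n : ℕ) [NeZero n] :
    ContinuousOn (fun k : Fin (d + 1) → ℂ => Dwi n (fun _ => (0 : Fin n)) k) (Fat (d + 1) (rA d)) := by
  unfold Dwi
  exact continuousOn_matrix_diagonal fun κ =>
    ((continuous_cweight n κ).comp (continuous_aliasPt n _)).continuousOn.inv₀ fun k hk => cw0_ne n hk κ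

/-- [folklore] `k ↦ Dwmi₀` is continuous on `Fat D rA`. -/
theorem continuousOn_Dwmi_zero (n : ℕ) [NeZero n] :
    ContinuousOn (fun k : Fin (d + 1) → ℂ => Dwmi n (fun _ => (0 : Fin n)) k) (Fat (d + 1) (rA d)) := by
  unfold Dwmi
  exact continuousOn_matrix_diagonal fun lam =>
    ((continuous_cweight n lam).comp (continuous_aliasPt n _).neg).continuousOn.inv₀ fun k hk => cwm0_ne n hk lam

/-- [our object] `k ↦ Ftil n k` is continuous on `Fat D rA`. -/
theorem continuousOn_Ftil (n : ℕ) [NeZero n] : ContinuousOn (fun k : Fin (d + 1) → ℂ => Ftil n k) (Fat (d + 1) (rA d)) := by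
  unfold Ftil
  refine continuousOn_finsetSum _ fun l hl => ?_
  unfold aliasTerm
  exact ((continuous_Dw n l).continuousOn.mul (continuousOn_PC_alias n (Finset.ne_of_mem_erase hl))).mul (continuous_Dwm n l).continuousOn

/-- [our object] **`k ↦ En n k` IS CONTINUOUS ON THE FAT REGION** (matrix-valued). -/
theorem continuousOn_En (n : ℕ) [NeZero n] : ContinuousOn (fun k : Fin (d + 1) → ℂ => En n k) (Fat (d + 1) (rA d)) := by
  unfold En
  exact (((continuousOn_feynC_alias n _).mul (continuousOn_Dwi_zero n)).mul (continuousOn_Ftil n)).mul (continuousOn_Dwmi_zero n)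

/-- [our object] `k ↦ Bn n k` is continuous on the fat region. -/
theorem continuousOn_Bn (n : ℕ) [NeZero n] : ContinuousOn (fun k : Fin (d + 1) → ℂ => Bn n k) (Fat (d + 1) (rA d)) := by
  unfold Bn
  exact continuousOn_const.add (continuousOn_En n)

end Summit.QuantumFields.BalabanUV.Beta.FP.CoarseCovarianceStripReg

end
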